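import Summits.AtomisticToContinuum.FouriersLaw.Theorems.OddSectorIrreversibilityWitnessGlueTangent
import Literature.MathematicalPhysics.KineticTheory.LangevinChainHarris
import Literature.MathematicalPhysics.KineticTheory.LangevinChainH2Proof

/-!
# `WitnessGlue` (stmt-AtomisticToContinuum-14072) — support 3: the open equilibrium kernels and the Green–Kubo pairing

Support file for `OddSectorIrreversibility.WitnessGlue`.

* **Invariance of the Gibbs weight under the OPEN equilibrium kernels from uniqueness of the weak
  steady state** (`bind_transitionKernel_gibbsWeight`): the invariant probability measure of
  `pinnedChainSemigroup` (Krylov–Bogoliubov from H2, in tree) is a weak steady state (Dynkin, in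
  tree), hence — under the route's `NessUnique` hypothesis at `(N, T, T)` — equals the Gibbs state.
* Consequences: `L²(μ_T)` contraction of `P_t`, the finite-horizon Kubo corrector
  `u_τ = ∫_{(0,τ]} P_t g dt` is in `L²(μ_T)` (so the `L²`-convergence clause of `CorrectorTheory` is an
  honest statement), Fubini `⟨g, u_τ⟩ = ∫_{(0,τ]} ⟨g, P_t g⟩ dt`, and the Green–Kubo pairing
  `⟨u, g⟩_{μ_T} = Z · ∫_0^∞ ⟨g, P_t g⟩_π dt` of the `L²`-limit `u` (`integral_corrector_mul_eq`).

No route statement is asserted.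
-/

noncomputable section

namespace Summit.AtomisticToContinuum.FouriersLaw.Theorems.OddSectorWitness

open MeasureTheory Filter Topology ProbabilityTheory Set
open scoped NNReal ENNReal
open Literature.MathematicalPhysics.KineticTheory.HeatConduction
open Summit.AtomisticToContinuum.FouriersLaw.Theorems.ClosedConeSensitivity.Negative.ZeroFrictionDictionary

variable {ω₂ lam β : ℝ} (hω : 0 < ω₂) (hl : 0 ≤ lam) (hβ : 0 ≤ β)
include hω hl hβ

/-! ## The open (equilibrium) kernels: invariance of the Gibbs weight, from uniqueness of the weak steady state -/

section OpenKernel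

variable {γ : ℝ} {N : ℕ} {T : ℝ} (hT : 0 < T)
include hT

/-- The Gibbs weight is the partition function times the (tilted, probability) Gibbs measure. [folklore] -/
theorem gibbsWeight_eq_smul_gibbsMeasure :
    gibbsWeight ω₂ lam β γ N T =
      (pinnedChain ω₂ lam β γ).partitionFunction N T • (pinnedChain ω₂ lam β γ).gibbsMeasure N T := by
  have hint := pinnedChain_integrable_gibbsDensity hω hl hβ γ N hT
  have hZ0 := (pinnedChain ω₂ lam β γ).partitionFunction_ne_zero (N := N) (T := T)
    (pinnedChain_continuous_gibbsDensity ω₂ lam β γ N T)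
  have hZt := (pinnedChain ω₂ lam β γ).partitionFunction_ne_top hint
  rw [(pinnedChain ω₂ lam β γ).gibbsMeasure_eq_smul_withDensity hint, smul_smul,
    ENNReal.mul_inv_cancel hZ0 hZt, one_smul]
  rfl

/-- The real partition function `Z = ∫ e^{-H/T} dq dp` is the `toReal` of the `ℝ≥0∞` one. [folklore] -/
theorem toReal_partitionFunction :
    ((pinnedChain ω₂ lam β γ).partitionFunction N T).toReal =
      ∫ x, Real.exp (-((pinnedChain ω₂ lam β γ).hamiltonian N x) / T) ∂volume := by
  rw [(pinnedChain ω₂ lam β γ).partitionFunction_eq_ofReal_integral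
    (pinnedChain_integrable_gibbsDensity hω hl hβ γ N hT), ENNReal.toReal_ofReal]
  · rfl
  · exact (integral_exp_pos (pinnedChain_integrable_gibbsDensity hω hl hβ γ N hT)).le

/-- Integrals against the Gibbs weight are `Z` times integrals against the Gibbs measure. [folklore] -/
theorem integral_gibbsWeight_eq_mul_integral_gibbsMeasure (f : PhaseSpace N → ℝ) :
    ∫ x, f x ∂(gibbsWeight ω₂ lam β γ N T) =
      (∫ x, Real.exp (-((pinnedChain ω₂ lam β γ).hamiltonian N x) / T) ∂volume) *
        ∫ x, f x ∂((pinnedChain ω₂ lam β γ).gibbsMeasure N T) := by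
  rw [gibbsWeight_eq_smul_gibbsMeasure hω hl hβ hT, integral_smul_measure,
    toReal_partitionFunction hω hl hβ hT, smul_eq_mul]

/-- **Invariance of the Gibbs weight under the open equilibrium dynamics, from uniqueness.**
If weak steady states of the `N`-site chain at equal bath temperatures `T` are unique, the Gibbs
weight is invariant under every transition kernel `P_t` of the OPEN chain (`γ > 0`): the invariant
probability measure of `pinnedChainSemigroup` (Krylov–Bogoliubov + H2, in tree) is a weak steady
state (Dynkin), hence equals the Gibbs state (a weak steady state, in tree), whose multiple the
weight is. [folklore] -/
theorem bind_transitionKernel_gibbsWeight (hβ' : 0 < β) (hγ : 0 < γ) (hN : 0 < N)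
    (hU : ∀ μ ν : Measure (PhaseSpace N), (pinnedChain ω₂ lam β γ).IsSteadyState N T T μ →
      (pinnedChain ω₂ lam β γ).IsSteadyState N T T ν → μ = ν) (t : ℝ≥0) :
    (gibbsWeight ω₂ lam β γ N T).bind ((pinnedChain ω₂ lam β γ).transitionKernel N T T t) =
      gibbsWeight ω₂ lam β γ N T := by
  obtain ⟨μ, hμ, hinv, hint⟩ := pinnedChainSemigroup_exists_isInvariant hω hl hβ' hγ hN hT hT
    CuneoEckmannHairerReyBellet2018_H2_holds
  have hϑ : (0 : ℝ) < 1 / (2 * T) := by positivity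
  have hϑ' : 1 / (2 * T) < 1 / max T T := by
    rw [max_self, one_div_lt_one_div (by positivity) hT]; linarith
  have hss := pinnedChain_isSteadyState_of_isInvariant hω.le hl hβ γ N _ hinv hϑ (hint _ hϑ hϑ')
  have hgs := pinnedChain_isSteadyState_gibbsMeasure hω hl hβ γ N hT
  have heq : μ = (pinnedChain ω₂ lam β γ).gibbsMeasure N T := hU _ _ hss hgs
  have hinvt := hinv t
  rw [Kernel.Invariant, pinnedChainSemigroup_kernel, heq] at hinvt
  rw [gibbsWeight_eq_smul_gibbsMeasure hω hl hβ hT, Measure.bind_smul, hinvt]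

/-- Lower Lebesgue integrals of kernel averages against the invariant Gibbs weight:
`∫ (P_t g) dμ_T = ∫ g dμ_T` for measurable `g ≥ 0`. [folklore] -/
theorem lintegral_transitionKernel_gibbsWeight (hβ' : 0 < β) (hγ : 0 < γ) (hN : 0 < N)
    (hU : ∀ μ ν : Measure (PhaseSpace N), (pinnedChain ω₂ lam β γ).IsSteadyState N T T μ →
      (pinnedChain ω₂ lam β γ).IsSteadyState N T T ν → μ = ν) (t : ℝ≥0)
    {g : PhaseSpace N → ℝ≥0∞} (hg : Measurable g) :
    ∫⁻ x, ∫⁻ y, g y ∂((pinnedChain ω₂ lam β γ).transitionKernel N T T t x) ∂(gibbsWeight ω₂ lam β γ N T) =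
      ∫⁻ x, g x ∂(gibbsWeight ω₂ lam β γ N T) := by
  conv_rhs => rw [← bind_transitionKernel_gibbsWeight hω hl hβ hT hβ' hγ hN hU t]
  rw [Measure.lintegral_bind ((pinnedChain ω₂ lam β γ).transitionKernel N T T t).measurable.aemeasurable
    hg.aemeasurable]

omit hT in
/-- The open kernels at real times `t ↦ P_{t⁺}` form a measurable family in `(t, x)`. [folklore] -/
theorem measurable_transitionKernel_real (hγ : 0 ≤ γ) :
    Measurable fun p : ℝ × PhaseSpace N => (pinnedChain ω₂ lam β γ).transitionKernel N T T p.1.toNNReal p.2 := by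
  have h := pinnedChain_measurable_transitionKernel hω hl hβ hγ N T T
  have hg : Measurable fun p : ℝ × PhaseSpace N => (p.1.toNNReal, p.2) :=
    (measurable_real_toNNReal.comp measurable_fst).prodMk measurable_snd
  have h2 := h.comp hg
  exact h2

omit hT in
/-- Kernel averages `(t, x) ↦ P_{t⁺} g (x)` of a strongly measurable observable are jointly strongly
measurable. [folklore] -/
theorem stronglyMeasurable_kernelAverage (hγ : 0 ≤ γ) {g : PhaseSpace N → ℝ} (hg : StronglyMeasurable g) :
    StronglyMeasurable fun p : ℝ × PhaseSpace N =>
      ∫ y, g y ∂((pinnedChain ω₂ lam β γ).transitionKernel N T T p.1.toNNReal p.2) := by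
  let K : Kernel (ℝ × PhaseSpace N) (PhaseSpace N) :=
    ⟨fun p => (pinnedChain ω₂ lam β γ).transitionKernel N T T p.1.toNNReal p.2,
      measurable_transitionKernel_real hω hl hβ hγ⟩
  exact StronglyMeasurable.integral_kernel (κ := K) hg

/-- **`L²` contraction of the open kernels on the invariant Gibbs weight** (`ℝ≥0∞` form, junk-proof):
`∫ (P_t g)² dμ_T ≤ ∫ g² dμ_T`. [folklore] -/
theorem lintegral_sq_kernelAverage_le (hβ' : 0 < β) (hγ : 0 < γ) (hN : 0 < N)
    (hU : ∀ μ ν : Measure (PhaseSpace N), (pinnedChain ω₂ lam β γ).IsSteadyState N T T μ →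
      (pinnedChain ω₂ lam β γ).IsSteadyState N T T ν → μ = ν) (t : ℝ≥0)
    {g : PhaseSpace N → ℝ} (hg : StronglyMeasurable g) :
    ∫⁻ x, ENNReal.ofReal ((∫ y, g y ∂((pinnedChain ω₂ lam β γ).transitionKernel N T T t x)) ^ 2)
        ∂(gibbsWeight ω₂ lam β γ N T) ≤
      ∫⁻ x, ENNReal.ofReal ((g x) ^ 2) ∂(gibbsWeight ω₂ lam β γ N T) := by
  haveI := pinnedChain_isMarkovKernel_transitionKernel hω hl hβ hγ.le N T T t
  calc _ ≤ ∫⁻ x, ∫⁻ y, ENNReal.ofReal ((g y) ^ 2) ∂((pinnedChain ω₂ lam β γ).transitionKernel N T T t x)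
        ∂(gibbsWeight ω₂ lam β γ N T) := by
        refine lintegral_mono fun x => ?_
        have h := ofReal_sq_integral_le (ν := (pinnedChain ω₂ lam β γ).transitionKernel N T T t x)
          hg.aestronglyMeasurable
        rwa [measure_univ, one_mul] at h
    _ = _ := lintegral_transitionKernel_gibbsWeight hω hl hβ hT hβ' hγ hN hU t
        ((hg.measurable.pow_const 2).ennreal_ofReal)

omit hT in
/-- The finite-horizon Kubo corrector `u_τ(x) = ∫_{(0,τ]} P_t g(x) dt` is strongly measurable. [folklore] -/
theorem stronglyMeasurable_finiteHorizon (hγ : 0 ≤ γ) {g : PhaseSpace N → ℝ} (hg : StronglyMeasurable g) (τ : ℝ) :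
    StronglyMeasurable fun x : PhaseSpace N => ∫ t in Ioc (0 : ℝ) τ,
      ∫ y, g y ∂((pinnedChain ω₂ lam β γ).transitionKernel N T T t.toNNReal x) := by
  have h := stronglyMeasurable_kernelAverage hω hl hβ (T := T) hγ hg
  have h' : StronglyMeasurable fun p : PhaseSpace N × ℝ =>
      ∫ y, g y ∂((pinnedChain ω₂ lam β γ).transitionKernel N T T p.2.toNNReal p.1) :=
    (h.measurable.comp measurable_swap).stronglyMeasurable
  exact h'.integral_prod_right' (ν := volume.restrict (Ioc (0 : ℝ) τ))

/-- **The finite-horizon corrector is in `L²(μ_T)`**, with `∫ u_τ² dμ_T ≤ τ² ∫ g² dμ_T` (`ℝ≥0∞` form):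
Jensen in time, Tonelli, and the `L²` contraction of each `P_t`. [folklore] -/
theorem lintegral_sq_finiteHorizon_le (hβ' : 0 < β) (hγ : 0 < γ) (hN : 0 < N)
    (hU : ∀ μ ν : Measure (PhaseSpace N), (pinnedChain ω₂ lam β γ).IsSteadyState N T T μ →
      (pinnedChain ω₂ lam β γ).IsSteadyState N T T ν → μ = ν)
    {g : PhaseSpace N → ℝ} (hg : StronglyMeasurable g) (τ : ℝ) :
    ∫⁻ x, ENNReal.ofReal ((∫ t in Ioc (0 : ℝ) τ,
        ∫ y, g y ∂((pinnedChain ω₂ lam β γ).transitionKernel N T T t.toNNReal x)) ^ 2) ∂(gibbsWeight ω₂ lam β γ N T) ≤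
      ENNReal.ofReal τ * ENNReal.ofReal τ * ∫⁻ x, ENNReal.ofReal ((g x) ^ 2) ∂(gibbsWeight ω₂ lam β γ N T) := by
  haveI := isFiniteMeasure_gibbsWeight hω hl hβ γ N hT
  set P := pinnedChain ω₂ lam β γ
  set F : ℝ × PhaseSpace N → ℝ := fun p => ∫ y, g y ∂(P.transitionKernel N T T p.1.toNNReal p.2) with hF
  have hFm : StronglyMeasurable F := stronglyMeasurable_kernelAverage hω hl hβ hγ.le hg
  have hvol : (volume.restrict (Ioc (0 : ℝ) τ)) univ = ENNReal.ofReal τ := by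
    rw [Measure.restrict_apply MeasurableSet.univ, univ_inter, Real.volume_Ioc, sub_zero]
  -- Jensen in time, pointwise in `x`
  have h1 : ∀ x, ENNReal.ofReal ((∫ t in Ioc (0 : ℝ) τ, F (t, x)) ^ 2) ≤
      ENNReal.ofReal τ * ∫⁻ t in Ioc (0 : ℝ) τ, ENNReal.ofReal ((F (t, x)) ^ 2) := by
    intro x
    have h := ofReal_sq_integral_le (ν := volume.restrict (Ioc (0 : ℝ) τ)) (f := fun t => F (t, x))
      (hFm.measurable.comp (measurable_id.prodMk measurable_const)).aestronglyMeasurable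
    rwa [hvol] at h
  -- Tonelli and the contraction
  have h2 : (∫⁻ x, (∫⁻ t in Ioc (0 : ℝ) τ, ENNReal.ofReal ((F (t, x)) ^ 2)) ∂(gibbsWeight ω₂ lam β γ N T)) =
      ∫⁻ t in Ioc (0 : ℝ) τ, ∫⁻ x, ENNReal.ofReal ((F (t, x)) ^ 2) ∂(gibbsWeight ω₂ lam β γ N T) := by
    refine lintegral_lintegral_swap ?_
    exact ((hFm.measurable.comp measurable_swap).pow_const 2).ennreal_ofReal.aemeasurable
  have h3 : ∀ t : ℝ, ∫⁻ x, ENNReal.ofReal ((F (t, x)) ^ 2) ∂(gibbsWeight ω₂ lam β γ N T) ≤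
      ∫⁻ x, ENNReal.ofReal ((g x) ^ 2) ∂(gibbsWeight ω₂ lam β γ N T) := fun t =>
    lintegral_sq_kernelAverage_le hω hl hβ hT hβ' hγ hN hU t.toNNReal hg
  calc _ ≤ ∫⁻ x, (ENNReal.ofReal τ * ∫⁻ t in Ioc (0 : ℝ) τ, ENNReal.ofReal ((F (t, x)) ^ 2))
        ∂(gibbsWeight ω₂ lam β γ N T) := lintegral_mono h1
    _ = ENNReal.ofReal τ * ∫⁻ t in Ioc (0 : ℝ) τ, ∫⁻ x, ENNReal.ofReal ((F (t, x)) ^ 2)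
        ∂(gibbsWeight ω₂ lam β γ N T) := by
        rw [lintegral_const_mul' _ _ ENNReal.ofReal_ne_top, h2]
    _ ≤ ENNReal.ofReal τ * ∫⁻ _t in Ioc (0 : ℝ) τ, ∫⁻ x, ENNReal.ofReal ((g x) ^ 2) ∂(gibbsWeight ω₂ lam β γ N T) := by
        exact mul_le_mul_right (lintegral_mono fun t => h3 t) _
    _ = _ := by
        rw [setLIntegral_const, Real.volume_Ioc, sub_zero]
        ring

/-- **The finite-horizon corrector is in `L²(μ_T)`** for a continuous observable with a polynomial
energy bound. [folklore] -/
theorem memLp_finiteHorizon (hβ' : 0 < β) (hγ : 0 < γ) (hN : 0 < N)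
    (hU : ∀ μ ν : Measure (PhaseSpace N), (pinnedChain ω₂ lam β γ).IsSteadyState N T T μ →
      (pinnedChain ω₂ lam β γ).IsSteadyState N T T ν → μ = ν)
    {g : PhaseSpace N → ℝ} (hg : Continuous g) (hg2 : MemLp g 2 (gibbsWeight ω₂ lam β γ N T)) (τ : ℝ) :
    MemLp (fun x : PhaseSpace N => ∫ t in Ioc (0 : ℝ) τ,
      ∫ y, g y ∂((pinnedChain ω₂ lam β γ).transitionKernel N T T t.toNNReal x)) 2 (gibbsWeight ω₂ lam β γ N T) := by
  have hsm := stronglyMeasurable_finiteHorizon hω hl hβ (T := T) hγ.le hg.stronglyMeasurable τ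
  refine (memLp_two_iff_integrable_sq hsm.aestronglyMeasurable).2 ⟨(hsm.measurable.pow_const 2).aestronglyMeasurable, ?_⟩
  rw [hasFiniteIntegral_iff_enorm]
  have hJ2 : ∫⁻ x, ENNReal.ofReal ((g x) ^ 2) ∂(gibbsWeight ω₂ lam β γ N T) < ⊤ := by
    have hint := (memLp_two_iff_integrable_sq hg.aestronglyMeasurable).1 hg2
    have := hint.hasFiniteIntegral
    rw [hasFiniteIntegral_iff_enorm] at this
    calc ∫⁻ x, ENNReal.ofReal ((g x) ^ 2) ∂(gibbsWeight ω₂ lam β γ N T)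
        = ∫⁻ x, ‖(g x) ^ 2‖ₑ ∂(gibbsWeight ω₂ lam β γ N T) :=
          lintegral_congr fun x => (Real.enorm_eq_ofReal (sq_nonneg _)).symm
      _ < ⊤ := this
  calc _ = ∫⁻ x, ENNReal.ofReal ((∫ t in Ioc (0 : ℝ) τ,
        ∫ y, g y ∂((pinnedChain ω₂ lam β γ).transitionKernel N T T t.toNNReal x)) ^ 2) ∂(gibbsWeight ω₂ lam β γ N T) :=
        lintegral_congr fun x => Real.enorm_eq_ofReal (sq_nonneg _)
    _ ≤ _ := lintegral_sq_finiteHorizon_le hω hl hβ hT hβ' hγ hN hU hg.stronglyMeasurable τ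
    _ < ⊤ := ENNReal.mul_lt_top (ENNReal.mul_lt_top ENNReal.ofReal_lt_top ENNReal.ofReal_lt_top) hJ2

/-- **Fubini for the finite-horizon corrector**: `⟨g, u_τ⟩_{μ_T} = ∫_{(0,τ]} ⟨g, P_t g⟩_{μ_T} dt`. [folklore] -/
theorem integral_mul_finiteHorizon (hβ' : 0 < β) (hγ : 0 < γ) (hN : 0 < N)
    (hU : ∀ μ ν : Measure (PhaseSpace N), (pinnedChain ω₂ lam β γ).IsSteadyState N T T μ →
      (pinnedChain ω₂ lam β γ).IsSteadyState N T T ν → μ = ν)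
    {g : PhaseSpace N → ℝ} (hg : Continuous g) (hg2 : MemLp g 2 (gibbsWeight ω₂ lam β γ N T)) (τ : ℝ) :
    ∫ x, g x * (∫ t in Ioc (0 : ℝ) τ, ∫ y, g y ∂((pinnedChain ω₂ lam β γ).transitionKernel N T T t.toNNReal x))
        ∂(gibbsWeight ω₂ lam β γ N T) =
      ∫ t in Ioc (0 : ℝ) τ, ∫ x, g x * (∫ y, g y ∂((pinnedChain ω₂ lam β γ).transitionKernel N T T t.toNNReal x))
        ∂(gibbsWeight ω₂ lam β γ N T) := by
  haveI := isFiniteMeasure_gibbsWeight hω hl hβ γ N hT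
  set P := pinnedChain ω₂ lam β γ
  set μ := gibbsWeight ω₂ lam β γ N T
  set F : ℝ × PhaseSpace N → ℝ := fun p => ∫ y, g y ∂(P.transitionKernel N T T p.1.toNNReal p.2) with hF
  have hFm : StronglyMeasurable F := stronglyMeasurable_kernelAverage hω hl hβ hγ.le hg.stronglyMeasurable
  have hg2int : Integrable (fun x => (g x) ^ 2) μ := (memLp_two_iff_integrable_sq hg.aestronglyMeasurable).1 hg2
  -- both factors are in `L²` of the product measure
  have hA : MemLp (fun p : ℝ × PhaseSpace N => g p.2) 2 ((volume.restrict (Ioc (0 : ℝ) τ)).prod μ) := by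
    refine (memLp_two_iff_integrable_sq (hg.aestronglyMeasurable.comp_snd)).2 ?_
    have := (integrable_const (μ := volume.restrict (Ioc (0 : ℝ) τ)) (1 : ℝ)).mul_prod hg2int
    simpa using this
  have hB : MemLp F 2 ((volume.restrict (Ioc (0 : ℝ) τ)).prod μ) := by
    refine (memLp_two_iff_integrable_sq hFm.aestronglyMeasurable).2 ⟨(hFm.measurable.pow_const 2).aestronglyMeasurable, ?_⟩
    rw [hasFiniteIntegral_iff_enorm, lintegral_prod _ ((hFm.measurable.pow_const 2).enorm).aemeasurable]
    have h3 : ∀ t : ℝ, ∫⁻ x, ‖(F (t, x)) ^ 2‖ₑ ∂μ ≤ ∫⁻ x, ENNReal.ofReal ((g x) ^ 2) ∂μ := by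
      intro t
      calc ∫⁻ x, ‖(F (t, x)) ^ 2‖ₑ ∂μ = ∫⁻ x, ENNReal.ofReal ((F (t, x)) ^ 2) ∂μ :=
            lintegral_congr fun x => Real.enorm_eq_ofReal (sq_nonneg _)
        _ ≤ _ := lintegral_sq_kernelAverage_le hω hl hβ hT hβ' hγ hN hU t.toNNReal hg.stronglyMeasurable
    have hJ2 : ∫⁻ x, ENNReal.ofReal ((g x) ^ 2) ∂μ < ⊤ := by
      have := hg2int.hasFiniteIntegral
      rw [hasFiniteIntegral_iff_enorm] at this
      calc ∫⁻ x, ENNReal.ofReal ((g x) ^ 2) ∂μ = ∫⁻ x, ‖(g x) ^ 2‖ₑ ∂μ :=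
            lintegral_congr fun x => (Real.enorm_eq_ofReal (sq_nonneg _)).symm
        _ < ⊤ := this
    calc ∫⁻ t in Ioc (0 : ℝ) τ, ∫⁻ x, ‖(F (t, x)) ^ 2‖ₑ ∂μ ≤ ∫⁻ _t in Ioc (0 : ℝ) τ, ∫⁻ x, ENNReal.ofReal ((g x) ^ 2) ∂μ :=
          lintegral_mono fun t => h3 t
      _ < ⊤ := by
          rw [setLIntegral_const, Real.volume_Ioc]
          exact ENNReal.mul_lt_top hJ2 ENNReal.ofReal_lt_top
  have hI : Integrable (fun p : ℝ × PhaseSpace N => g p.2 * F p) ((volume.restrict (Ioc (0 : ℝ) τ)).prod μ) :=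
    hA.integrable_mul hB
  have hswap := integral_integral_swap (μ := volume.restrict (Ioc (0 : ℝ) τ)) (ν := μ)
    (f := fun t x => g x * F (t, x)) hI
  rw [hswap]
  refine integral_congr_ae (Eventually.of_forall fun x => ?_)
  simp only [hF]
  rw [← integral_const_mul]

/-- **Green–Kubo pairing of the corrector.** If `u` is the `L²(μ_T)`-limit of the finite-horizon
correctors `u_τ = ∫_{(0,τ]} P_t g dt` of a continuous square-integrable observable `g`, and the
equilibrium autocorrelation `c(t) = ⟨g, P_t g⟩_π` (`π` the Gibbs state) is integrable on `(0,∞)` with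
integral `E`, then `⟨u, g⟩_{μ_T} = Z · E` (`Z` the partition function): Fubini, the invariance-based
`L²` bounds, and Cauchy–Schwarz. [folklore] -/
theorem integral_corrector_mul_eq (hβ' : 0 < β) (hγ : 0 < γ) (hN : 0 < N)
    (hU : ∀ μ ν : Measure (PhaseSpace N), (pinnedChain ω₂ lam β γ).IsSteadyState N T T μ →
      (pinnedChain ω₂ lam β γ).IsSteadyState N T T ν → μ = ν)
    {g : PhaseSpace N → ℝ} (hg : Continuous g) (hg2 : MemLp g 2 (gibbsWeight ω₂ lam β γ N T))
    {u : PhaseSpace N → ℝ} (hu : MemLp u 2 (gibbsWeight ω₂ lam β γ N T))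
    (hL2 : Tendsto (fun τ : ℝ => ∫ x, ((∫ t in Ioc (0 : ℝ) τ,
        ∫ y, g y ∂((pinnedChain ω₂ lam β γ).transitionKernel N T T t.toNNReal x)) - u x) ^ 2
          ∂(gibbsWeight ω₂ lam β γ N T)) atTop (𝓝 0))
    {E : ℝ}
    (hBint : IntegrableOn (fun t : ℝ => ∫ z, g z *
        (∫ y, g y ∂((pinnedChain ω₂ lam β γ).transitionKernel N T T t.toNNReal z))
          ∂((pinnedChain ω₂ lam β γ).gibbsMeasure N T)) (Ioi 0))
    (hBeq : E = ∫ t in Ioi (0 : ℝ), ∫ z, g z *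
        (∫ y, g y ∂((pinnedChain ω₂ lam β γ).transitionKernel N T T t.toNNReal z))
          ∂((pinnedChain ω₂ lam β γ).gibbsMeasure N T)) :
    ∫ x, u x * g x ∂(gibbsWeight ω₂ lam β γ N T) =
      (∫ x, Real.exp (-((pinnedChain ω₂ lam β γ).hamiltonian N x) / T) ∂volume) * E := by
  set P := pinnedChain ω₂ lam β γ
  set μ := gibbsWeight ω₂ lam β γ N T
  set Z : ℝ := ∫ x, Real.exp (-(P.hamiltonian N x) / T) ∂volume
  set uτ : ℝ → PhaseSpace N → ℝ := fun τ x => ∫ t in Ioc (0 : ℝ) τ,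
    ∫ y, g y ∂(P.transitionKernel N T T t.toNNReal x) with huτ
  set cπ : ℝ → ℝ := fun t => ∫ z, g z * (∫ y, g y ∂(P.transitionKernel N T T t.toNNReal z)) ∂(P.gibbsMeasure N T)
  -- Step 1–2: Fubini and normalisation
  have hf : ∀ τ : ℝ, ∫ x, g x * uτ τ x ∂μ = Z * ∫ t in Ioc (0 : ℝ) τ, cπ t := by
    intro τ
    rw [integral_mul_finiteHorizon hω hl hβ hT hβ' hγ hN hU hg hg2 τ, ← integral_const_mul]
    refine setIntegral_congr_fun measurableSet_Ioc fun t _ => ?_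
    exact integral_gibbsWeight_eq_mul_integral_gibbsMeasure hω hl hβ hT _
  -- Step 3: the time integral converges to the Green–Kubo integral
  have hlim1 : Tendsto (fun τ : ℝ => ∫ x, g x * uτ τ x ∂μ) atTop (𝓝 (Z * E)) := by
    simp_rw [hf]
    refine Tendsto.const_mul Z ?_
    have h := intervalIntegral_tendsto_integral_Ioi (μ := volume) (f := cπ) 0 hBint tendsto_id
    rw [hBeq]
    refine h.congr' ?_
    filter_upwards [eventually_ge_atTop (0 : ℝ)] with τ hτ
    exact intervalIntegral.integral_of_le hτ
  -- Step 4: `L²` convergence of the correctors gives convergence of the pairings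
  have hlim2 : Tendsto (fun τ : ℝ => ∫ x, g x * uτ τ x ∂μ) atTop (𝓝 (∫ x, g x * u x ∂μ)) := by
    have hmem : ∀ τ, MemLp (uτ τ) 2 μ := fun τ => memLp_finiteHorizon hω hl hβ hT hβ' hγ hN hU hg hg2 τ
    have hdiff : ∀ τ, ∫ x, g x * uτ τ x ∂μ - ∫ x, g x * u x ∂μ = ∫ x, g x * (uτ τ x - u x) ∂μ := by
      intro τ
      have h1 : Integrable (fun x => g x * uτ τ x) μ := hg2.integrable_mul (hmem τ)
      have h2 : Integrable (fun x => g x * u x) μ := hg2.integrable_mul hu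
      rw [← integral_sub h1 h2]
      refine integral_congr_ae (Eventually.of_forall fun x => ?_)
      ring
    have hbound : ∀ τ, ‖∫ x, g x * uτ τ x ∂μ - ∫ x, g x * u x ∂μ‖ ≤
        Real.sqrt (∫ x, (g x) ^ 2 ∂μ) * Real.sqrt (∫ x, (uτ τ x - u x) ^ 2 ∂μ) := by
      intro τ
      rw [hdiff, Real.norm_eq_abs]
      exact abs_integral_mul_le_sqrt hg2 ((hmem τ).sub hu)
    have hsqrt : Tendsto (fun τ : ℝ => Real.sqrt (∫ x, (g x) ^ 2 ∂μ) * Real.sqrt (∫ x, (uτ τ x - u x) ^ 2 ∂μ))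
        atTop (𝓝 0) := by
      have hL2' : Tendsto (fun τ : ℝ => ∫ x, (uτ τ x - u x) ^ 2 ∂μ) atTop (𝓝 0) := hL2
      have h0 : Tendsto (fun τ : ℝ => Real.sqrt (∫ x, (uτ τ x - u x) ^ 2 ∂μ)) atTop (𝓝 0) := by
        have := (Real.continuous_sqrt.tendsto 0).comp hL2'
        rw [Real.sqrt_zero] at this
        exact this
      simpa using h0.const_mul (Real.sqrt (∫ x, (g x) ^ 2 ∂μ))
    have := squeeze_zero_norm hbound hsqrt
    rw [tendsto_sub_nhds_zero_iff] at this
    exact this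
  -- Step 5
  have heq := tendsto_nhds_unique hlim2 hlim1
  rw [← heq]
  refine integral_congr_ae (Eventually.of_forall fun x => ?_)
  simp only
  ring

end OpenKernel

end Summit.AtomisticToContinuum.FouriersLaw.Theorems.OddSectorWitness
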